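import Summits.Schanuel.Schanuel.Theorems.RootDecomp1BQuadFrame01

/-!
# RootDecomp1BQuadFrame — lens 4, generation 36 ADDENDUM «QUADRATIC FRAMES» (B-R23 (ii)(b)): the (1|ρ) At-cells and 5 ≤ polarDeg (1, ρ) for EVERY ρ ∈ `QuadHyperLiouville` (hyper-approximable by real quadratic irrationals) modulo `Roy2014_thm_1_1` ONLY, with the NAMED member ρ_Q = √2 + λ_H of FINITE irrationality exponent — continuation (RootDecomp1BQuadFrame02): §D `qpt`, `QuadHyperLiouville`, `QuadFrameMeasure` + §R `quadFrameMeasure_of_roy` (Roy uniform along the varying quadratic frame)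

(lens-4 g36 ADDENDUM `QuadFrame.lean` [HOME/decomp-schanuel-lens-4/g36/ sha256 ffb0c3af…, 1516 l; NODE L1950 / REQUEST L1951; critic VERDICT L1957 (B-R23 (ii)(b) cell credit, RULE B-R24, port GO)]; port by census-1 gen 17 as
`RootDecomp1BQuadFrame01`–`05` — see the PORT NOTE of part 01; `--supports stmt-Schanuel-32406`; rung 0.)
-/

noncomputable section

open Complex IntermediateField MvPolynomial

namespace Summit.Schanuel.Schanuel.Theorems.RootDecomp1BQuadFrame

open Summit.Schanuel.Schanuel.Theorems.RootDecomp1EPointTransfer (Roy2014_thm_1_1)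
open Summit.Schanuel.Schanuel.Theorems.RootDecomp1KHyper (mvlen mvlen_nonneg abs_coeff_le_mvlen one_le_mvlen
  exists_ball_eval_ne_zero mvlen_add_le mvlen_sub_le mvlen_mul_le mvlen_C_mul_le mvlen_sum_le)
open Summit.Schanuel.Schanuel.Theorems.RootDecomp1BHyperFrame (royDeg royS RoyNF roy_tree_iff framePt Ff
  Ff_eq_aeval exists_lipschitz_Ff gcoef gcoef_ne_zero apply_zero_le_totalDegree engine_endgame
  trdeg_adjoin_le_of_isAlgebraic' linearIndependent_one_irrational)
open Summit.Schanuel.Schanuel.Theorems.RootDecomp1BFedFlagCore (KleinIH polarDeg polarField)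
open Summit.Schanuel.Schanuel.Theorems.RootDecomp1BDefectFloorDefs (SharpRelativeLindemannAt TameDefectZeroAt
  WildSharpDefectZeroAt WildSharpDefectZeroInitAt WildSharpInitAt)
open Summit.Schanuel.Schanuel.Theorems.RootDecomp1BDefectFloorCells (natCast_le_trdeg_of_algebraicIndependent)
open Summit.Schanuel.Schanuel.Theorems.RootDecomp1BRadicalDescent (exists_int_relation norm_mvaeval_le_mvlen)
open Summit.Schanuel.Schanuel.Theorems.RootDecomp1BMovingZero (mem_polarField_one mem_polarField_swap)

/-! ## §D  The quadratic frame point, the class, the measure -/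

section Defs

/-- the polar directions `y = (1, 1, i, i)` of the column `(1 | x)` -/
def qy : Fin 4 → ℂ := ![1, 1, I, I]

/-- the exponent pattern `e = (0, 1, 0, 1)` -/
def qe : Fin 4 → ℕ := ![0, 1, 0, 1]

/-- the MOVING LINDEMANN–WEIERSTRASS POINT `α_x = (x^{e_j} y_j)_j = (1, x, i, ix)` of the column `(1 | x)` -/
def qpt (x : ℝ) : Fin 4 → ℂ := fun j => ((x : ℝ) : ℂ) ^ (qe j) * qy j

/-- Coordinates of the quadratic frame point `qpt β = (1, β, i, iβ)`. -/
theorem qpt_apply (x : ℝ) : qpt x = ![(1 : ℂ), (x : ℂ), I, (x : ℂ) * I] := by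
  funext j
  fin_cases j <;> simp [qpt, qy, qe]

/-- the frame point of the engine is `(x, e^{α_x})` -/
theorem framePt_qy_qe (x : ℝ) : framePt qy qe x = Fin.cons (x : ℂ) (fun j => cexp (qpt x j)) := rfl

/-- **THE CLASS `QuadHyperLiouville`** (Koksma `w₂*(ρ) = ∞` in the strong «hyper» normalisation): for every `m`
there is a REAL QUADRATIC IRRATIONAL `β ≠ ρ`, root of `aZ² + bZ + c` (`a ≠ 0`, `|a|, |b|, |c| ≤ A`, `A ≥ m`), with
`|ρ − β| < exp(−A^m)`.  (Contains Mahler `U₂`-numbers with BOUNDED PARTIAL QUOTIENTS — quasi-periodic continued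
fractions — which NO rational-approximation regime `|ρ − p/q| < q^{−μ}`, `μ > 2`, let alone `e^{−q^m}`, reaches.)
TYPING NOTES. `ρ` is REAL only (the frame `(1, β, i, iβ)` and the norm form `U² − bUV + acV²` are real-quadratic
devices).  The conjunct `β ≠ ρ` (i.e. `0 < |ρ − β|`) is LOAD-BEARING: at `ρ = β` a real quadratic irrational,
Lindemann–Weierstrass gives `t(1, β) = 4` exactly, so no `5` can hold there; the irrationality of `β` is part of the
class (a rational `β` gives a non-free frame, `HyperFrame05.not_linearIndependent_one_I_rat`). A named member with
FINITE irrationality exponent is `rhoQ = √2 + λ_H` (§M). -/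
def QuadHyperLiouville (ρ : ℝ) : Prop :=
  ∀ m : ℕ, ∃ (β : ℝ) (a b c : ℤ) (A : ℕ), m ≤ A ∧ Irrational β ∧ a ≠ 0 ∧
    (a : ℝ) * β ^ 2 + b * β + c = 0 ∧ |a| ≤ (A : ℤ) ∧ |b| ≤ (A : ℤ) ∧ |c| ≤ (A : ℤ) ∧
    β ≠ ρ ∧ |ρ - β| < Real.exp (-((A : ℝ) ^ m))

/-- **QUADRATIC FRAME MEASURE**: a Lindemann–Weierstrass measure at the moving point `α_β = (1, β, i, iβ)` which is
UNIFORM over all real quadratic irrationals `β` of naive height `≤ A`:  for every degree `D` there are `C ≥ 0`, `N`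
with `|P(e^{α_β})| ≥ exp(−C (log H + A^N))` for every non-zero `P ∈ ℤ[X₁..X₄]` of degree `≤ D`, height `≤ H`. -/
def QuadFrameMeasure : Prop :=
  ∀ D : ℕ, ∃ (C : ℝ) (N : ℕ), 0 ≤ C ∧
    ∀ (β : ℝ) (a b c : ℤ) (A : ℕ), Irrational β → a ≠ 0 →
      (a : ℝ) * β ^ 2 + b * β + c = 0 → |a| ≤ (A : ℤ) → |b| ≤ (A : ℤ) → |c| ≤ (A : ℤ) →
    ∀ P : MvPolynomial (Fin 4) ℤ, P ≠ 0 → P.totalDegree ≤ D →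
    ∀ H : ℕ, 1 ≤ H → (∀ s, |P.coeff s| ≤ (H : ℤ)) →
      Real.exp (-(C * (Real.log H + (A : ℝ) ^ N))) ≤ ‖MvPolynomial.aeval (fun j => cexp (qpt β j)) P‖

end Defs

/-! ## §R  Roy ⟹ the quadratic frame measure (varying number field `ℚ(β, i)`, degree `≤ 4` uniformly) -/

section RoyAdapter

/-- An integer is an algebraic integer in `ℂ`. -/
private theorem isIntegral_intCast_QF (z : ℤ) : IsIntegral ℤ (z : ℂ) := by
  simpa using (isIntegral_algebraMap (R := ℤ) (A := ℂ) (x := z))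

/-- `i` is an algebraic integer. -/
private theorem isIntegral_I_QF : IsIntegral ℤ I := by
  refine ⟨Polynomial.X ^ 2 + Polynomial.C 1, Polynomial.monic_X_pow_add_C 1 two_ne_zero, ?_⟩
  simp [Polynomial.eval₂_add, Polynomial.eval₂_X_pow, Complex.I_sq]

/-- `aβ` is an algebraic integer for a root `β` of `aZ² + bZ + c`: it is a root of `Z² + bZ + ac`. -/
theorem isIntegral_mul_quadRoot {a b c : ℤ} {z : ℂ} (hz : (a : ℂ) * z ^ 2 + b * z + c = 0) :
    IsIntegral ℤ ((a : ℂ) * z) := by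
  refine ⟨Polynomial.X ^ 2 + (Polynomial.C b * Polynomial.X + Polynomial.C (a * c)),
    Polynomial.monic_X_pow_add ?_, ?_⟩
  · refine lt_of_le_of_lt (Polynomial.degree_add_le _ _) (max_lt ?_ ?_)
    · exact lt_of_le_of_lt (Polynomial.degree_C_mul_X_le _) (by exact_mod_cast Nat.lt_succ_self 1)
    · exact lt_of_le_of_lt Polynomial.degree_C_le (by exact_mod_cast Nat.succ_pos 1)
  · simp only [Polynomial.eval₂_add, Polynomial.eval₂_mul, Polynomial.eval₂_X_pow, Polynomial.eval₂_C,
      Polynomial.eval₂_X]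
    simp only [algebraMap_int_eq, eq_intCast, Int.cast_mul]
    linear_combination (a : ℂ) * hz

/-- HOUSE BOUND: every root `z` of `aZ² + bZ + c` (`a ≠ 0`, `|a|, |b|, |c| ≤ A`) has `|z| ≤ 2A`. -/
theorem norm_quadRoot_le {a b c : ℤ} {A : ℕ} (ha : a ≠ 0) (haA : |a| ≤ (A : ℤ)) (hbA : |b| ≤ (A : ℤ))
    (hcA : |c| ≤ (A : ℤ)) {z : ℂ} (hz : (a : ℂ) * z ^ 2 + b * z + c = 0) : ‖z‖ ≤ 2 * A := by
  have ha1 : (1 : ℝ) ≤ |(a : ℝ)| := by exact_mod_cast Int.one_le_abs ha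
  have haR : |(a : ℝ)| ≤ A := by exact_mod_cast haA
  have hbR : |(b : ℝ)| ≤ A := by exact_mod_cast hbA
  have hcR : |(c : ℝ)| ≤ A := by exact_mod_cast hcA
  have hA1 : (1 : ℝ) ≤ A := ha1.trans haR
  by_cases hz1 : ‖z‖ ≤ 1
  · linarith
  · push Not at hz1
    have heq : (a : ℂ) * z ^ 2 = -((b : ℂ) * z + c) := by linear_combination hz
    have h1 : |(a : ℝ)| * ‖z‖ ^ 2 ≤ |(b : ℝ)| * ‖z‖ + |(c : ℝ)| := by
      have h := congrArg (fun w : ℂ => ‖w‖) heq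
      simp only [norm_mul, norm_pow, norm_neg, Complex.norm_intCast] at h
      rw [h]
      calc ‖(b : ℂ) * z + c‖ ≤ ‖(b : ℂ) * z‖ + ‖(c : ℂ)‖ := norm_add_le _ _
        _ = |(b : ℝ)| * ‖z‖ + |(c : ℝ)| := by rw [norm_mul, Complex.norm_intCast, Complex.norm_intCast]
    have h2 : ‖z‖ ^ 2 ≤ |(a : ℝ)| * ‖z‖ ^ 2 := le_mul_of_one_le_left (by positivity) ha1
    have h3 : |(b : ℝ)| * ‖z‖ + |(c : ℝ)| ≤ (2 * A) * ‖z‖ := by nlinarith [abs_nonneg (c : ℝ)]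
    have h4 : ‖z‖ * ‖z‖ ≤ (2 * A) * ‖z‖ := by nlinarith
    exact le_of_mul_le_mul_right h4 (by linarith)

/-- `(1, β, i, iβ)` is ℚ-FREE for `β ∉ ℚ` (the exact evasion of the (L−) wall `β ∈ ℚ` of HyperFrame05). -/
theorem linearIndependent_qpt {β : ℝ} (hirr : Irrational β) : LinearIndependent ℚ (qpt β) := by
  have key : ∀ u v : ℚ, (u : ℝ) + v * β = 0 → u = 0 ∧ v = 0 := by
    intro u v h
    by_cases hv : v = 0
    · rw [hv, Rat.cast_zero, zero_mul, add_zero] at h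
      exact ⟨by exact_mod_cast h, hv⟩
    · exfalso
      have hvR : (v : ℝ) ≠ 0 := by exact_mod_cast hv
      refine hirr ⟨-u / v, ?_⟩
      push_cast
      field_simp
      linarith
  rw [qpt_apply, Fintype.linearIndependent_iff]
  intro g hg
  rw [Fin.sum_univ_four] at hg
  simp only [Matrix.cons_val_zero, Matrix.cons_val_one, Matrix.cons_val] at hg
  have hre := congrArg Complex.re hg
  have him := congrArg Complex.im hg
  simp [Rat.smul_def] at hre him
  obtain ⟨h0, h1⟩ := key (g 0) (g 1) (by linarith)
  obtain ⟨h2, h3⟩ := key (g 2) (g 3) (by linarith)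
  intro i
  fin_cases i
  exacts [h0, h1, h2, h3]

/-- a root `z` of a quadratic `aZ² + bZ + c ∈ ℤ[Z]`, `a ≠ 0`, is integral over `ℚ` with `[ℚ(z):ℚ] ≤ 2` -/
theorem finrank_adjoin_quadRoot_le {a b c : ℤ} (ha : a ≠ 0) {z : ℂ}
    (hz : (a : ℂ) * z ^ 2 + b * z + c = 0) :
    IsIntegral ℚ z ∧ Module.finrank ℚ ℚ⟮z⟯ ≤ 2 := by
  obtain ⟨p, hp⟩ : ∃ p : Polynomial ℚ,
      p = Polynomial.C (a : ℚ) * Polynomial.X ^ 2 + Polynomial.C (b : ℚ) * Polynomial.X + Polynomial.C (c : ℚ) :=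
    ⟨_, rfl⟩
  have hp0 : p ≠ 0 := by
    intro h
    have h2 : p.coeff 2 = 0 := by rw [h, Polynomial.coeff_zero]
    simp only [hp, Polynomial.coeff_add, Polynomial.coeff_C_mul, Polynomial.coeff_X_pow, Polynomial.coeff_X,
      Polynomial.coeff_C] at h2
    norm_num at h2
    exact ha (by exact_mod_cast h2)
  have hpz : Polynomial.aeval z p = 0 := by
    have : Polynomial.aeval z p = (a : ℂ) * z ^ 2 + b * z + c := by
      rw [hp]
      simp
    rw [this, hz]
  have halg : IsAlgebraic ℚ z := ⟨p, hp0, hpz⟩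
  have hint : IsIntegral ℚ z := halg.isIntegral
  refine ⟨hint, ?_⟩
  rw [IntermediateField.adjoin.finrank hint]
  have h1 := minpoly.degree_le_of_ne_zero ℚ z hp0 hpz
  have h2 : p.degree ≤ 2 := by rw [hp]; exact Polynomial.degree_quadratic_le
  exact Polynomial.natDegree_le_iff_degree_le.mpr (h1.trans h2)

set_option maxHeartbeats 800000 in
/-- **ROY ⟹ QUADRATIC FRAME MEASURE.**  Along the quadratic frame the number field `K_β = ℚ(β, i)` VARIES, but Roy's
bound depends on the point only through the degree `d = [ℚ(α_β):ℚ] ≤ 4`, the house `≤ 2A` and the denominator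
`a² ≤ A²` — all uniform in the naive height `A`; hence a measure of the stated shape, uniform in `β`. -/
theorem quadFrameMeasure_of_roy (hRoy : Roy2014_thm_1_1) : QuadFrameMeasure := by
  have hRoy : RoyNF := roy_tree_iff.mp hRoy
  classical
  intro D
  -- constants depending on `D` only
  obtain ⟨D', hD'⟩ : ∃ D' : ℕ, D' = D + 1 := ⟨_, rfl⟩
  obtain ⟨S₀, hS₀⟩ : ∃ S₀ : ℕ, S₀ = royS 4 4 D' := ⟨_, rfl⟩
  have hS₀pos : 0 < S₀ := by rw [hS₀]; unfold royS; rw [hD']; positivity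
  obtain ⟨E₀, hE₀⟩ : ∃ E₀ : ℕ, E₀ = 18 * S₀ ^ 4 := ⟨_, rfl⟩
  obtain ⟨Aexp, hAexp⟩ : ∃ Aexp : ℕ, Aexp = 12 * S₀ ^ 4 := ⟨_, rfl⟩
  obtain ⟨B₀, hB₀⟩ : ∃ B₀ : ℝ, B₀ = (2 * (S₀ : ℝ)) ^ E₀ := ⟨_, rfl⟩
  have hB₀0 : 0 ≤ B₀ := by rw [hB₀]; positivity
  refine ⟨(Aexp : ℝ) + B₀, 3 * E₀, add_nonneg (Nat.cast_nonneg _) hB₀0, ?_⟩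
  intro β a b c A hirr ha0 hβ haA hbA hcA P hP hPD H hH hPH
  -- the real/complex forms of the quadratic equation
  have hβC : (a : ℂ) * ((β : ℝ) : ℂ) ^ 2 + b * ((β : ℝ) : ℂ) + c = 0 := by exact_mod_cast hβ
  have hA1Z : (1 : ℤ) ≤ A := le_trans (Int.one_le_abs ha0) haA
  have hA1 : (1 : ℝ) ≤ A := by exact_mod_cast hA1Z
  have hA0 : (0 : ℝ) ≤ A := le_trans zero_le_one hA1
  -- the number field `K = ℚ(β) ⊔ ℚ(i)` and its degree
  obtain ⟨hβint, hβdeg⟩ := finrank_adjoin_quadRoot_le ha0 hβC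
  have hI2' : ((1 : ℤ) : ℂ) * I ^ 2 + (0 : ℤ) * I + (1 : ℤ) = 0 := by simp
  obtain ⟨hIint, hIdeg⟩ := finrank_adjoin_quadRoot_le (a := 1) (b := 0) (c := 1) one_ne_zero hI2'
  haveI : FiniteDimensional ℚ ℚ⟮((β : ℝ) : ℂ)⟯ := IntermediateField.adjoin.finiteDimensional hβint
  haveI : FiniteDimensional ℚ ℚ⟮I⟯ := IntermediateField.adjoin.finiteDimensional hIint
  set K : IntermediateField ℚ ℂ := ℚ⟮((β : ℝ) : ℂ)⟯ ⊔ ℚ⟮I⟯ with hKdef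
  haveI hKfd : FiniteDimensional ℚ ↥K := IntermediateField.finiteDimensional_sup _ _
  have hKdeg : Module.finrank ℚ ↥K ≤ 4 :=
    (IntermediateField.finrank_sup_le _ _).trans (by nlinarith [hβdeg, hIdeg, Nat.zero_le (Module.finrank ℚ ℚ⟮I⟯)])
  have hβK : ((β : ℝ) : ℂ) ∈ K := (le_sup_left : ℚ⟮((β : ℝ) : ℂ)⟯ ≤ K) (mem_adjoin_simple_self ℚ _)
  have hIK : I ∈ K := (le_sup_right : ℚ⟮I⟯ ≤ K) (mem_adjoin_simple_self ℚ _)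
  have hmem : ∀ j, qpt β j ∈ K := by
    intro j
    rw [qpt_apply]
    fin_cases j
    · simp
    · simpa using hβK
    · simpa using hIK
    · simpa using mul_mem hβK hIK
  let α : Fin 4 → ↥K := fun j => ⟨qpt β j, hmem j⟩
  have hαcoe : ∀ j, (α j : ℂ) = qpt β j := fun j => rfl
  -- the elements `β, i` of `K` and their equations
  let βK : ↥K := ⟨((β : ℝ) : ℂ), hβK⟩
  let IK : ↥K := ⟨I, hIK⟩
  have hinj : Function.Injective (algebraMap ↥K ℂ) := (algebraMap ↥K ℂ).injective
  have hβKeq : (a : ↥K) * βK ^ 2 + (b : ↥K) * βK + (c : ↥K) = 0 := by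
    apply hinj
    rw [map_add, map_add, map_mul, map_mul, map_pow, map_intCast, map_intCast, map_intCast, map_zero]
    exact hβC
  have hIKeq : IK ^ 2 = -1 := by
    apply hinj
    rw [map_pow, map_neg, map_one]
    exact Complex.I_sq
  have hαK : ∀ j, α j = ![(1 : ↥K), βK, IK, βK * IK] j := by
    intro j
    apply Subtype.ext
    rw [hαcoe, qpt_apply]
    fin_cases j <;> simp [βK, IK]
  -- ℚ-linear independence
  have hαli : LinearIndependent ℚ (fun j => (α j : ℂ)) := linearIndependent_qpt hirr
  -- the house `≤ 2A`
  have hconj : ∀ (j : Fin 4) (σ : ↥K →ₐ[ℚ] ℂ), ‖σ (α j)‖ ≤ 2 * A := by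
    intro j σ
    have hσβ : ‖σ βK‖ ≤ 2 * A := by
      refine norm_quadRoot_le ha0 haA hbA hcA (z := σ βK) ?_
      have h := congrArg σ hβKeq
      rwa [map_add, map_add, map_mul, map_mul, map_pow, map_intCast, map_intCast, map_intCast, map_zero] at h
    have hσI : ‖σ IK‖ = 1 := by
      have h := congrArg σ hIKeq
      rw [map_pow, map_neg, map_one] at h
      have h2 : ‖σ IK‖ ^ 2 = 1 := by
        have := congrArg (fun w : ℂ => ‖w‖) h
        simpa [norm_pow] using this
      exact (pow_eq_one_iff_of_nonneg (norm_nonneg _) two_ne_zero).mp h2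
    have h12 : (1 : ℝ) ≤ 2 * A := by linarith
    rw [hαK j]
    fin_cases j
    · simpa using h12
    · simpa using hσβ
    · simp [hσI]; linarith
    · simpa [hσI] using hσβ
  -- the denominator `q = a²`
  obtain ⟨q, hq⟩ : ∃ q : ℕ, q = (a * a).toNat := ⟨_, rfl⟩
  have hqZ : (q : ℤ) = a * a := by rw [hq]; exact Int.toNat_of_nonneg (mul_self_nonneg a)
  have hqpos : 0 < q := by
    have h : (0 : ℤ) < (q : ℤ) := by rw [hqZ]; exact mul_self_pos.mpr ha0
    exact_mod_cast h
  have hqC : (q : ℂ) = (a : ℂ) * (a : ℂ) := by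
    have h : ((q : ℤ) : ℂ) = ((a * a : ℤ) : ℂ) := by rw [hqZ]
    push_cast at h
    exact h
  have hqR : (q : ℝ) = (a : ℝ) * (a : ℝ) := by
    have h : ((q : ℤ) : ℝ) = ((a * a : ℤ) : ℝ) := by rw [hqZ]
    push_cast at h
    exact h
  have hγint : IsIntegral ℤ ((a : ℂ) * ((β : ℝ) : ℂ)) := isIntegral_mul_quadRoot hβC
  have hqint : ∀ j, IsIntegral ℤ ((q : ℂ) * (α j : ℂ)) := by
    have h0 : IsIntegral ℤ (q : ℂ) := by rw [hqC, ← Int.cast_mul]; exact isIntegral_intCast_QF _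
    have h1 : IsIntegral ℤ ((q : ℂ) * ((β : ℝ) : ℂ)) := by
      rw [hqC, mul_assoc]; exact (isIntegral_intCast_QF a).mul hγint
    have h2 : IsIntegral ℤ ((q : ℂ) * I) := h0.mul isIntegral_I_QF
    have h3 : IsIntegral ℤ ((q : ℂ) * (((β : ℝ) : ℂ) * I)) := by
      rw [← mul_assoc]; exact h1.mul isIntegral_I_QF
    intro j
    rw [hαcoe, qpt_apply]
    fin_cases j
    exacts [by simpa using h0, by simpa using h1, by simpa using h2, by simpa using h3]
  -- Roy's theorem at `α_β`
  have hD'pos : 0 < D' := by rw [hD']; exact Nat.succ_pos D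
  have hPD' : P.totalDegree ≤ D' := hPD.trans (by rw [hD']; exact Nat.le_succ D)
  have hHpos : 0 < H := hH
  have hroy := hRoy 4 K hKfd α hαli (2 * A) hconj q hqpos hqint D' H hD'pos hHpos P hP hPD' hPH
  -- the degree `d ≤ 4`
  obtain ⟨dα, hdα⟩ : ∃ dα : ℕ, royDeg (fun i => (α i : ℂ)) = dα := ⟨_, rfl⟩
  have hd4 : dα ≤ 4 := by
    rw [← hdα]
    unfold royDeg
    have hle : IntermediateField.adjoin ℚ (Set.range fun i => (α i : ℂ)) ≤ K := by
      rw [IntermediateField.adjoin_le_iff]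
      rintro _ ⟨j, rfl⟩
      exact (α j).2
    exact (IntermediateField.finrank_le_of_le_right hle).trans hKdeg
  rw [hdα] at hroy
  obtain ⟨S, hS⟩ : ∃ S : ℕ, royS 4 dα D' = S := ⟨_, rfl⟩
  rw [hS] at hroy
  have hSle : S ≤ S₀ := by
    rw [← hS, hS₀]
    unfold royS
    gcongr
  have hpt : (fun i => cexp (α i : ℂ)) = fun j => cexp (qpt β j) := rfl
  rw [hpt] at hroy
  refine le_trans ?_ hroy
  -- compare the two shapes
  have hH1 : (1 : ℝ) ≤ H := by exact_mod_cast hH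
  have hHposR : (0 : ℝ) < H := by positivity
  have hlogH : 0 ≤ Real.log H := Real.log_nonneg hH1
  have hexp1 : 3 * dα * S ^ 4 ≤ Aexp := by
    rw [hAexp]
    calc 3 * dα * S ^ 4 ≤ 3 * 4 * S₀ ^ 4 := by gcongr
      _ = 12 * S₀ ^ 4 := by ring
  have hexp2 : 18 * S ^ 4 ≤ E₀ := by rw [hE₀]; gcongr
  have hinv : ((H : ℝ) ^ Aexp)⁻¹ ≤ ((H : ℝ) ^ (3 * dα * S ^ 4))⁻¹ :=
    inv_anti₀ (pow_pos hHposR _) (pow_le_pow_right₀ hH1 hexp1)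
  have hHA : ((H : ℝ) ^ Aexp)⁻¹ = Real.exp (-(Aexp * Real.log H)) := by
    rw [← Real.log_pow, Real.exp_neg, Real.exp_log (pow_pos hHposR _)]
  have haR : |(a : ℝ)| ≤ A := by exact_mod_cast haA
  have hqA : (q : ℝ) ≤ (A : ℝ) ^ 2 := by
    rw [hqR]
    have : (a : ℝ) * a = |(a : ℝ)| * |(a : ℝ)| := (abs_mul_abs_self _).symm
    rw [this, sq]
    exact mul_le_mul haR haR (abs_nonneg _) hA0
  have hS₀1 : (1 : ℝ) ≤ S₀ := by exact_mod_cast hS₀pos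
  have hSR : (S : ℝ) ≤ S₀ := by exact_mod_cast hSle
  have hbase : 2 * (A : ℝ) * (q : ℝ) * (S : ℝ) ≤ 2 * (S₀ : ℝ) * (A : ℝ) ^ 3 := by
    have h1 : 2 * (A : ℝ) * (q : ℝ) * (S : ℝ) ≤ 2 * (A : ℝ) * (A : ℝ) ^ 2 * (S₀ : ℝ) :=
      mul_le_mul (mul_le_mul_of_nonneg_left hqA (by positivity)) hSR (Nat.cast_nonneg _) (by positivity)
    calc _ ≤ _ := h1
      _ = 2 * (S₀ : ℝ) * (A : ℝ) ^ 3 := by ring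
  have hbase1 : (1 : ℝ) ≤ 2 * (S₀ : ℝ) * (A : ℝ) ^ 3 := by
    have h1 : (1 : ℝ) ≤ (A : ℝ) ^ 3 := one_le_pow₀ hA1
    nlinarith
  have hbase0 : (0 : ℝ) ≤ 2 * (A : ℝ) * (q : ℝ) * (S : ℝ) := by positivity
  have hpowE : (2 * (A : ℝ) * (q : ℝ) * (S : ℝ)) ^ (18 * S ^ 4) ≤ B₀ * (A : ℝ) ^ (3 * E₀) := by
    calc (2 * (A : ℝ) * (q : ℝ) * (S : ℝ)) ^ (18 * S ^ 4) ≤ (2 * (S₀ : ℝ) * (A : ℝ) ^ 3) ^ (18 * S ^ 4) :=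
        pow_le_pow_left₀ hbase0 hbase _
      _ ≤ (2 * (S₀ : ℝ) * (A : ℝ) ^ 3) ^ E₀ := pow_le_pow_right₀ hbase1 hexp2
      _ = B₀ * (A : ℝ) ^ (3 * E₀) := by rw [hB₀, mul_pow, ← pow_mul]
  have hANn : (0 : ℝ) ≤ (A : ℝ) ^ (3 * E₀) := by positivity
  have hAexp0 : (0 : ℝ) ≤ Aexp := Nat.cast_nonneg _
  have hsum : Aexp * Real.log H + (2 * (A : ℝ) * (q : ℝ) * (S : ℝ)) ^ (18 * S ^ 4) ≤
      ((Aexp : ℝ) + B₀) * (Real.log H + (A : ℝ) ^ (3 * E₀)) := by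
    nlinarith [hpowE, mul_nonneg hAexp0 hANn, mul_nonneg hB₀0 hlogH]
  calc Real.exp (-(((Aexp : ℝ) + B₀) * (Real.log H + (A : ℝ) ^ (3 * E₀))))
      ≤ Real.exp (-(Aexp * Real.log H + (2 * (A : ℝ) * (q : ℝ) * (S : ℝ)) ^ (18 * S ^ 4))) :=
        Real.exp_le_exp.mpr (neg_le_neg hsum)
    _ = ((H : ℝ) ^ Aexp)⁻¹ * Real.exp (-((2 * (A : ℝ) * (q : ℝ) * (S : ℝ)) ^ (18 * S ^ 4))) := by
        rw [hHA, ← Real.exp_add]; congr 1; ring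
    _ ≤ ((H : ℝ) ^ (3 * dα * S ^ 4))⁻¹ * Real.exp (-((2 * (A : ℝ) * (q : ℝ) * (S : ℝ)) ^ (18 * S ^ 4))) :=
        mul_le_mul_of_nonneg_right hinv (Real.exp_pos _).le

end RoyAdapter

end Summit.Schanuel.Schanuel.Theorems.RootDecomp1BQuadFrame

end
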